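import Literature.Computability.QuantumComplexity.GRMassTable
import Literature.Computability.QuantumComplexity.GRCosineWord
import Literature.Computability.Complexity.MachinPiFP
import Literature.Computability.Complexity.TM2PassThrough
import Literature.Computability.Complexity.EasyWitnessSearch
import Literature.Computability.Cryptography.PolyTimeComputablePowerSeries
import HarnessLib

/-!
# The cosine word of the Grover–Rudolph level machine is polynomial-time on codes

Topic `Literature/Computability/QuantumComplexity`; the typed half of the cosine machine of the
Grover–Rudolph block (Regev 2009, Lemma 3.12, proof: "the approximations … can be computed efficiently",
§2 p. 11). On the code of the parameters `((S, (p, U)), (k, ℓ))` (`S` rational, `p, U, k, ℓ` unary) and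
of the level input `(j, h)` (`j` unary, `h` binary) the map to the cosine word
`cosWord k (aOf k (T j h) (T (j+1) (2h)))`, `T = GRMassTable.tableT S p U ℓ`, is `CodeFP` — assembled
from the typed combinators of `CodeFP.lean` / `CodeFPArith.lean` / `CodeFPRat.lean`, `ratRound`
(`MachinPiFP.lean`), `ratPow` and `codeFP_gaussFApprox`:

* leaves: `pow2Un` (`1ⁿ ↦ 2ⁿ`), `ratNeg'`, `ratSub'`, `ratNonpos` (`q ≤ 0` through `q.num ≤ 0`),
  `codeFP_sG`, `codeFP_tableT'` (the table computed through `2^ℓ / 2^j` and `max 1 (2^ℓ/2)`, equal to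
  `tableT` for `j ≤ ℓ`: `tableT'_eq`), `codeFP_aOf`;
* the output: `wordOfNat k A = (natE (2^k − A + 2^{k+1})).take (k+1)` with **`wordOfNat_eq_cosWord`**, and
  **`codeFP_levelWord`**: the whole map `LevelIn ↦ strE`.

Everything here is proved; definitions have bodies; no named fact is introduced. The raw-string
parser of the machine's input `d ++ v` and the `FP` machine are the sequel.

## References

* O. Regev, J. ACM 56 (2009), art. 34, Lemma 3.12 (proof), §2 p. 11 [Regev2009].
* S. Arora, B. Barak, *Computational Complexity: A Modern Approach*, CUP 2009, §1.2–1.3 [AroraBarak2009].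
-/

noncomputable section

namespace Literature.Computability.QuantumComplexity

open Literature.Computability.Complexity Literature.Computability.Complexity.CodeFP
  Literature.Computability.Complexity.GaussIntegral GaussianCells GRMassTable
open _root_.Computability
open Literature.Algebra.EuclideanLattices (encodeRat)
open Literature.Computability.Cryptography (PowerSeriesFP.ratPow)

namespace GRCosineCodeFP

/-! ### Leaves -/

/-- `1ⁿ ↦ 2ⁿ` in binary. [folklore] -/
theorem pow2Un : CodeFP unE natE (fun n => 2 ^ n) :=
  (natPow.comp ((const unE (2 : ℕ)).pair (CodeFP.id unE))).congr fun _ => rfl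

/-- Negation of a rational on codes. [folklore] -/
theorem ratNeg' : CodeFP encodeRat encodeRat (fun q : ℚ => -q) :=
  (ratMul.comp ((CodeFP.id encodeRat).pair (const encodeRat (-1 : ℚ)))).congr fun q => by simp

/-- Subtraction of rationals on codes. [folklore] -/
theorem ratSub' : CodeFP (pairE encodeRat encodeRat) encodeRat (fun p => p.1 - p.2) :=
  (ratAdd.comp ((fst _ _).pair (ratNeg'.comp (snd _ _)))).congr fun p => by simp [sub_eq_add_neg]

/-- The test `q ≤ 0` on codes (through `q.num ≤ 0`). [folklore] -/
theorem ratNonpos : CodeFP encodeRat bitE (fun q : ℚ => decide (q ≤ 0)) :=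
  (intLe.comp (ratNumDen.fst'.pair (const encodeRat (0 : ℤ)))).congr fun q => by
    simp only [Rat.num_nonpos]

variable (S : ℚ) (p U : ℕ)

/-- **The signed approximation on codes**: `(params, x) ↦ sG S p U x`. [cite: Regev2009, §2 p. 11] -/
theorem codeFP_sG : CodeFP (pairE (pairE encodeRat (pairE unE unE)) intE) encodeRat (fun q => sG q.1.1 q.1.2.1 q.1.2.2 q.2) := by
  have hS : CodeFP (pairE (pairE encodeRat (pairE unE unE)) intE) encodeRat (fun q => q.1.1) := (fst _ _).fst'
  have hp : CodeFP (pairE (pairE encodeRat (pairE unE unE)) intE) unE (fun q => q.1.2.1) := (fst _ _).snd'.fst'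
  have hU : CodeFP (pairE (pairE encodeRat (pairE unE unE)) intE) unE (fun q => q.1.2.2) := (fst _ _).snd'.snd'
  have hx : CodeFP (pairE (pairE encodeRat (pairE unE unE)) intE) intE (fun q => q.2) := snd _ _
  have hpos : CodeFP (pairE (pairE encodeRat (pairE unE unE)) intE) encodeRat
      (fun q => gaussFApprox q.1.1 q.2.toNat q.1.2.1 q.1.2.2) :=
    (codeFP_gaussFApprox.comp ((hS.pair (intToNat.comp hx)).pair (hp.pair hU))).congr fun _ => rfl
  have hneg : CodeFP (pairE (pairE encodeRat (pairE unE unE)) intE) encodeRat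
      (fun q => -gaussFApprox q.1.1 (-q.2).toNat q.1.2.1 q.1.2.2) :=
    (ratNeg'.comp (codeFP_gaussFApprox.comp ((hS.pair (intToNat.comp (intNeg.comp hx))).pair (hp.pair hU)))).congr fun _ => rfl
  have htest : CodeFP (pairE (pairE encodeRat (pairE unE unE)) intE) bitE (fun q => decide ((0 : ℤ) ≤ q.2)) :=
    (intLe.comp ((const _ (0 : ℤ)).pair hx)).congr fun _ => rfl
  exact (ite htest hpos hneg).congr fun q => by unfold sG; by_cases h : (0 : ℤ) ≤ q.2 <;> simp [h]

/-! ### The table -/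

/-- **The table computed by the machine**: as `tableT` but with `2^ℓ / 2^j` for `2^{ℓ−j}` and
`max 1 (2^ℓ/2)` for `2^{ℓ−1}` (equal for `j ≤ ℓ`). [folklore] -/
def tableT' (ℓ j h : ℕ) : ℚ :=
  sG S p U (((h * (2 ^ ℓ / 2 ^ j) : ℕ) : ℤ) + ((2 ^ ℓ / 2 ^ j : ℕ) : ℤ) - ((max 1 (2 ^ ℓ / 2) : ℕ) : ℤ)) -
    sG S p U (((h * (2 ^ ℓ / 2 ^ j) : ℕ) : ℤ) - ((max 1 (2 ^ ℓ / 2) : ℕ) : ℤ))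

variable {S p U}

/-- The machine's table is the mass table for `j ≤ ℓ`. [folklore] -/
theorem tableT'_eq {ℓ j : ℕ} (hj : j ≤ ℓ) (h : ℕ) : tableT' S p U ℓ j h = tableT S p U ℓ j h := by
  have e1 : 2 ^ ℓ / 2 ^ j = 2 ^ (ℓ - j) := Nat.pow_div hj (by norm_num)
  have e2 : max 1 (2 ^ ℓ / 2) = 2 ^ (ℓ - 1) := by
    rcases Nat.eq_zero_or_pos ℓ with rfl | hℓ
    · simp
    · obtain ⟨m, rfl⟩ : ∃ m, ℓ = m + 1 := ⟨ℓ - 1, by omega⟩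
      rw [show 2 ^ (m + 1) / 2 = 2 ^ (m + 1 - 1) by rw [pow_succ, Nat.mul_div_cancel _ two_pos, Nat.add_sub_cancel],
        max_eq_right Nat.one_le_two_pow]
  unfold tableT' tableT hiZ loZ
  rw [e1, e2]
  push_cast
  ring_nf

variable (S p U)

/-- The parameter code: `((S, (p, U)), (k, ℓ))`. [folklore] -/
abbrev parE : (ℚ × (ℕ × ℕ)) × (ℕ × ℕ) → List Bool := pairE (pairE encodeRat (pairE unE unE)) (pairE unE unE)

/-- The level-input code: `(params, (j, h))`, `j` unary, `h` binary. [folklore] -/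
abbrev inE : ((ℚ × (ℕ × ℕ)) × (ℕ × ℕ)) × (ℕ × ℕ) → List Bool := pairE parE (pairE unE natE)

/-- The type of level inputs. [folklore] -/
abbrev LevelIn : Type := ((ℚ × (ℕ × ℕ)) × (ℕ × ℕ)) × (ℕ × ℕ)

/-- **The table on codes**: `(params, (j, h)) ↦ tableT' S p U ℓ j h`. [cite: Regev2009, Lemma 3.12 (proof)] -/
theorem codeFP_tableT' : CodeFP inE encodeRat (fun q : LevelIn => tableT' q.1.1.1 q.1.1.2.1 q.1.1.2.2 q.1.2.2 q.2.1 q.2.2) := by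
  have hpar : CodeFP inE (pairE encodeRat (pairE unE unE)) (fun q : LevelIn => q.1.1) := (fst _ _).fst'
  have hℓ : CodeFP inE unE (fun q : LevelIn => q.1.2.2) := (fst _ _).snd'.snd'
  have hj : CodeFP inE unE (fun q : LevelIn => q.2.1) := (snd _ _).fst'
  have hh : CodeFP inE natE (fun q : LevelIn => q.2.2) := (snd _ _).snd'
  have h2ℓ : CodeFP inE natE (fun q : LevelIn => 2 ^ q.1.2.2) := (pow2Un.comp hℓ :)
  have h2j : CodeFP inE natE (fun q : LevelIn => 2 ^ q.2.1) := (pow2Un.comp hj :)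
  have hw : CodeFP inE natE (fun q : LevelIn => 2 ^ q.1.2.2 / 2 ^ q.2.1) := (natDiv.comp (h2ℓ.pair h2j) :)
  have hhalf : CodeFP inE natE (fun q : LevelIn => max 1 (2 ^ q.1.2.2 / 2)) :=
    (natMax.comp ((const _ (1 : ℕ)).pair (natDiv.comp (h2ℓ.pair (const _ (2 : ℕ))))) :)
  have hlo0 : CodeFP inE natE (fun q : LevelIn => q.2.2 * (2 ^ q.1.2.2 / 2 ^ q.2.1)) := (natMul.comp (hh.pair hw) :)
  have hloZ : CodeFP inE intE (fun q : LevelIn => ((q.2.2 * (2 ^ q.1.2.2 / 2 ^ q.2.1) : ℕ) : ℤ) - ((max 1 (2 ^ q.1.2.2 / 2) : ℕ) : ℤ)) :=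
    (intSub.comp ((intOfNat.comp hlo0).pair (intOfNat.comp hhalf)) :)
  have hhiZ : CodeFP inE intE (fun q : LevelIn => ((q.2.2 * (2 ^ q.1.2.2 / 2 ^ q.2.1) : ℕ) : ℤ) + ((2 ^ q.1.2.2 / 2 ^ q.2.1 : ℕ) : ℤ) -
      ((max 1 (2 ^ q.1.2.2 / 2) : ℕ) : ℤ)) :=
    (intSub.comp ((intAdd.comp ((intOfNat.comp hlo0).pair (intOfNat.comp hw))).pair (intOfNat.comp hhalf)) :)
  have hsGhi : CodeFP inE encodeRat (fun q : LevelIn => sG q.1.1.1 q.1.1.2.1 q.1.1.2.2 (((q.2.2 * (2 ^ q.1.2.2 / 2 ^ q.2.1) : ℕ) : ℤ) + ((2 ^ q.1.2.2 / 2 ^ q.2.1 : ℕ) : ℤ) -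
      ((max 1 (2 ^ q.1.2.2 / 2) : ℕ) : ℤ))) := (codeFP_sG.comp (hpar.pair hhiZ) :)
  have hsGlo : CodeFP inE encodeRat (fun q : LevelIn => sG q.1.1.1 q.1.1.2.1 q.1.1.2.2 (((q.2.2 * (2 ^ q.1.2.2 / 2 ^ q.2.1) : ℕ) : ℤ) - ((max 1 (2 ^ q.1.2.2 / 2) : ℕ) : ℤ))) :=
    (codeFP_sG.comp (hpar.pair hloZ) :)
  exact (ratSub'.comp (hsGhi.pair hsGlo)).congr fun _ => rfl

/-! ### The cosine numerator -/

/-- **`aOf` on codes**: `(k, (P̂, P̂₀)) ↦ aOf k P̂ P̂₀` (`k` unary). [cite: Regev2009, Lemma 3.12 (proof) with §2 p. 11] -/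
theorem codeFP_aOf : CodeFP (pairE unE (pairE encodeRat encodeRat)) natE (fun q => aOf q.1 q.2.1 q.2.2) := by
  have hk : CodeFP (pairE unE (pairE encodeRat encodeRat)) unE (fun q => q.1) := fst _ _
  have hP : CodeFP (pairE unE (pairE encodeRat encodeRat)) encodeRat (fun q => q.2.1) := (snd _ _).fst'
  have hP0 : CodeFP (pairE unE (pairE encodeRat encodeRat)) encodeRat (fun q => q.2.2) := (snd _ _).snd'
  have h2k : CodeFP (pairE unE (pairE encodeRat encodeRat)) natE (fun q => 2 ^ q.1) := (pow2Un.comp hk :)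
  have h4k : CodeFP (pairE unE (pairE encodeRat encodeRat)) encodeRat (fun q => (4 : ℚ) ^ q.1) :=
    (PowerSeriesFP.ratPow.comp ((const _ (4 : ℚ)).pair hk) :)
  have hr : CodeFP (pairE unE (pairE encodeRat encodeRat)) natE
      (fun q => (Nat.sqrt (round ((4 : ℚ) ^ q.1 * (q.2.2 / q.2.1))).toNat)) :=
    (natSqrt.comp (intToNat.comp (ratRound.comp (ratMul.comp (h4k.pair (ratDiv.comp (hP0.pair hP)))))) :)
  have hmin : CodeFP (pairE unE (pairE encodeRat encodeRat)) natE
      (fun q => min (2 ^ q.1) (Nat.sqrt (round ((4 : ℚ) ^ q.1 * (q.2.2 / q.2.1))).toNat)) := (natMin.comp (h2k.pair hr) :)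
  have htest : CodeFP (pairE unE (pairE encodeRat encodeRat)) bitE (fun q => decide (q.2.1 ≤ 0)) := (ratNonpos.comp hP :)
  exact (ite htest h2k hmin).congr fun q => by unfold aOf; by_cases h : q.2.1 ≤ 0 <;> simp [h]

/-! ### The output word -/

/-- **The machine's output word**: the first `k+1` bits of the numeral of `2^{k+1} + (2^k − A)`. [folklore] -/
def wordOfNat (k A : ℕ) : List Bool := (natE (2 ^ (k + 1) + (2 ^ k - A))).take (k + 1)

/-- The numeral of `2^w + m` (`m < 2^w`) has `w + 1` bits. [folklore] -/
theorem length_natE_two_pow_add {w m : ℕ} (hm : m < 2 ^ w) : (natE (2 ^ w + m)).length = w + 1 := by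
  rw [show natE (2 ^ w + m) = encodeNat (2 ^ w + m) from rfl, TM2Pass.length_encodeNat_eq_size]
  apply le_antisymm
  · exact Nat.size_le.2 (by rw [pow_succ]; omega)
  · exact Nat.lt_size.2 (by omega)

/-- The bits of a numeral, as optional entries. [folklore] -/
theorem getElem?_natE {x i : ℕ} (hi : i < (natE x).length) : (natE x)[i]? = some (x.testBit i) := by
  obtain ⟨b, hb⟩ : ∃ b, (natE x)[i]? = some b := ⟨_, List.getElem?_eq_getElem hi⟩
  have h := EasyWitness.getD_encodeNat x i
  rw [List.getD_eq_getElem?_getD, show encodeNat x = natE x from rfl, hb, Option.getD_some] at h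
  rw [hb, h]

/-- **The machine's output word is the cosine word.** [cite: Regev2009, Lemma 3.12 (proof)] -/
theorem wordOfNat_eq_cosWord (k A : ℕ) : wordOfNat k A = cosWord k A := by
  have hF : 2 ^ k - A < 2 ^ (k + 1) := lt_of_le_of_lt (Nat.sub_le _ _) (Nat.pow_lt_pow_right (by norm_num) (Nat.lt_succ_self k))
  have hlen := length_natE_two_pow_add hF
  unfold wordOfNat cosWord bitsLE
  refine List.ext_getElem? fun i => ?_
  rw [List.getElem?_take, List.getElem?_ofFn]
  by_cases hi : i < k + 1
  · rw [if_pos hi, getElem?_natE (by rw [hlen]; omega), Nat.testBit_two_pow_add_gt hi]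
    simp [hi]
  · rw [if_neg hi]
    simp [hi]

/-- The output word on codes: `(k, A) ↦ wordOfNat k A` (`k` unary). [folklore] -/
theorem codeFP_wordOfNat : CodeFP (pairE unE natE) strE (fun q => wordOfNat q.1 q.2) := by
  have hk : CodeFP (pairE unE natE) unE (fun q => q.1) := fst _ _
  have hA : CodeFP (pairE unE natE) natE (fun q => q.2) := snd _ _
  have h2k : CodeFP (pairE unE natE) natE (fun q => 2 ^ q.1) := (pow2Un.comp hk :)
  have h2k1 : CodeFP (pairE unE natE) natE (fun q => 2 ^ (q.1 + 1)) := (pow2Un.comp (unSucc.comp hk) :)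
  have hm : CodeFP (pairE unE natE) natE (fun q => 2 ^ (q.1 + 1) + (2 ^ q.1 - q.2)) := (natAdd.comp (h2k1.pair (natSub.comp (h2k.pair hA))) :)
  have hs : CodeFP (pairE unE natE) strE (fun q => natE (2 ^ (q.1 + 1) + (2 ^ q.1 - q.2))) := (strOfNat.comp hm :)
  exact (strTake.comp ((unSucc.comp hk).pair hs)).congr fun _ => rfl

/-! ### The level word -/

/-- **The cosine numerator of the level on codes**: `(params, (j, h)) ↦ aOf k (T' j h) (T' (j+1) (2h))`.
[cite: Regev2009, Lemma 3.12 (proof)] -/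
theorem codeFP_levelA : CodeFP inE natE (fun q : LevelIn =>
    aOf q.1.2.1 (tableT' q.1.1.1 q.1.1.2.1 q.1.1.2.2 q.1.2.2 q.2.1 q.2.2) (tableT' q.1.1.1 q.1.1.2.1 q.1.1.2.2 q.1.2.2 (q.2.1 + 1) (2 * q.2.2))) := by
  have hk : CodeFP inE unE (fun q : LevelIn => q.1.2.1) := (fst _ _).snd'.fst'
  have hpar : CodeFP inE parE (fun q : LevelIn => q.1) := fst _ _
  have hj : CodeFP inE unE (fun q : LevelIn => q.2.1) := (snd _ _).fst'
  have hh : CodeFP inE natE (fun q : LevelIn => q.2.2) := (snd _ _).snd'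
  -- the shifted level input `(params, (j+1, 2h))`
  have hshift : CodeFP inE inE (fun q : LevelIn => (q.1, (q.2.1 + 1, 2 * q.2.2))) :=
    (hpar.pair ((unSucc.comp hj).pair (natMul.comp ((const _ (2 : ℕ)).pair hh))) :)
  have hT0 : CodeFP inE encodeRat (fun q : LevelIn => tableT' q.1.1.1 q.1.1.2.1 q.1.1.2.2 q.1.2.2 (q.2.1 + 1) (2 * q.2.2)) :=
    (codeFP_tableT'.comp hshift :)
  exact (codeFP_aOf.comp (hk.pair (codeFP_tableT'.pair hT0))).congr fun _ => rfl

/-- **The cosine word of the level on codes.** [cite: Regev2009, Lemma 3.12 (proof) with §2 p. 11] -/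
theorem codeFP_levelWord : CodeFP inE strE (fun q : LevelIn =>
    wordOfNat q.1.2.1 (aOf q.1.2.1 (tableT' q.1.1.1 q.1.1.2.1 q.1.1.2.2 q.1.2.2 q.2.1 q.2.2)
      (tableT' q.1.1.1 q.1.1.2.1 q.1.1.2.2 q.1.2.2 (q.2.1 + 1) (2 * q.2.2)))) := by
  have hk : CodeFP inE unE (fun q : LevelIn => q.1.2.1) := (fst _ _).snd'.fst'
  exact (codeFP_wordOfNat.comp (hk.pair codeFP_levelA)).congr fun _ => rfl

end GRCosineCodeFP

end Literature.Computability.QuantumComplexity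

end
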